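import Summits.BirchSwinnertonDyer.BirchSwinnertonDyer.Theorems.PrintCf2SplitBadTwoCMShaEigenMiddleFactorH1
import Summits.BirchSwinnertonDyer.BirchSwinnertonDyer.Theorems.PrintCf2SplitBadTwoRestrictedSelmerLocalTrivialAwayFromP
import Literature.NumberTheory.EllipticCurves.KummerSelmerStructure
import Mathlib.Tactic.Module
import HarnessLib

/-!
# Crux `PrintCf2.SplitBadTwoRankOneOfFacts` (item stmt-BirchSwinnertonDyer-20368), road α, S3c₂ bottom value: the CM input (H1″) at `v`
# REDUCED TO A STATEMENT ABOUT RATIONAL LOCAL POINTS — «`π` acts on `E(K_v) ⊗ ℤ_p` modulo torsion as the scalar `1 − r`»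

Cell `bsd-print-cf2`, width seat `bsd-line-cf2-p1-w8` g2 (brick **B6g**); `--supports stmt-BirchSwinnertonDyer-20368` (helper, Theses-free).
HONEST FRAMING: nothing here closes a crux or a stub; BSD is not proved by any of this; no summit statement is proved by this seat. No
definition, no named fact, no `sorry`. beyond-print theorem: no.

WHAT. After p669645 the factor (F2) of (R-BV) rests on the single Galois-cohomological input (H1″)
`ι_*⁻¹(localKerOver p ⊤ K_v) ≤ ker res_{⊤ ⊓ D_v}` on `H¹(K, E[𝔮_r^∞])`. This file proves (H1″) from a statement about POINTS, the form in
which the local CM arithmetic (formal group, `log(πP) = ι_v(α)·log P`, T4 of the cell's plan) naturally delivers it: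

(H1-pts) **the CM scalar on local points.** There is a `Γ_{K_v}`-equivariant additive `f_v : E(K̄_v) → E(K̄_v)` extending `π`
(`f_v ∘ ι_* = ι_* ∘ π`; e.g. `Isogeny.localPointsMap`) such that for every `K_v`-rational `y ∈ E(K̄_v)` and every `n` there are a
`K_v`-rational `y′` and an integer `N₁ ≡ 1 − r (mod p^n)` with `f_v y − N₁ y − p^n y′` a `p`-power torsion point — i.e. `π − (1 − r)` maps
`E(K_v) ⊗ ℤ_p` into `⋂ p^n (E(K_v) ⊗ ℤ_p) + torsion`: the `E[𝔮_r^∞]`-idempotent kills `E(K_v) ⊗ ℚ_p/ℤ_p` (prime-to-`p` torsion is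
`p`-divisible and goes into `y′`).

* §1 `resH1Hom_subtype_mem_awayKer_of_cmScalar` — under (H1-pts), a class `ι_* c` (`c ∈ H¹(⊤, E[𝔮_r^∞])`) that is CLASSICAL at `v` (dies in
  `H¹(Γ_{K_v}, E(K̄_v))`) is LOCALLY ZERO at `v` (dies in `H¹(⊤ ⊓ D_v, E[p^∞])`). Proof = -w7 g2's `localKerOver_top_le_awayKer` (the case
  `v ∤ p`, where `E(K_v) ⊗ ℚ_p/ℤ_p = 0` outright) with the CM twist: the cocycle is `τ ↦ τQ − Q` with `y = p^J Q` rational (`p^J` kills the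
  values); the operator `ψ = b(π − N₁)` (`N′ ≡ r`, `N₁ ≡ 1 − r (mod p^{J+1})`, `b (N′ − N₁) ≡ 1 (mod p^J)`) FIXES the values (they lie in
  `E[𝔮_r^∞][p^J]`, where `π = N′`) and maps `Q` to `Q′ = b(f_v Q − N₁ Q)` with `p^J Q′ = ψ y = p^J y₀ + (torsion)`, `y₀ = b p y′` rational; so
  the cocycle is `τ ↦ τT − T` with `T = Q′ − y₀` torsion, hence algebraic (`torsionPointsEquiv`), a coboundary on the decomposition group.
* §1 `comap_localKerOver_le_ker_resOfLe_of_cmScalar` — **(H1″) ⟸ (H1-pts)** (ι_* is injective on `H¹(⊤ ⊓ D_v, ·)`, -w7 g2 p662922).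
* §2 `padicValNat_trueSelmer_quotient_eq_sha_of_frame_of_cmScalar` — ON EVERY S3c₂ FRAME, hF2's inner statement of
  `rBV_of_three_factor_values` VERBATIM ⟸ (H1-pts) at `v` (existential `f_v`), by p669645.

References: R. Greenberg, LNM 1716 (1999) §2 Prop. 2.1–2.2, pp. 62–63, 70–73 [GreenbergLNM1716]; K. Rubin, LNM 1716 (1999) §3 Lemma 3.6,
Cor. 3.17 [Rubin1999]; A. Agboola, Compositio 143 (2007) §3, §6 [Agboola2007]; J.-P. Serre, *Galois Cohomology* I.§2 [SerreGaloisCohomology1997].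
-/

noncomputable section

open scoped Classical

set_option linter.dupNamespace false
set_option autoImplicit false

open NumberField IsDedekindDomain Field
open Literature.NumberTheory.EllipticCurves Literature.NumberTheory.EllipticCurves.GreenbergSelmer
open Literature.NumberTheory.EllipticCurves.Castella2018.AcSelmer
open Literature.NumberTheory.EllipticCurves.Agboola2007
open Literature.NumberTheory.EllipticCurves.ResKernel
open Literature.NumberTheory.EllipticCurves.Greenberg1999 Literature.NumberTheory.EllipticCurves.CocycleCriteria
open Literature.NumberTheory.GaloisRepresentations
open Summit.BirchSwinnertonDyer.BirchSwinnertonDyer.Theorems.PrintCf2.RestrictedSelmerPair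
open Summit.BirchSwinnertonDyer.BirchSwinnertonDyer.Theorems.PrintCf2.AdditiveAtSeven

universe u

namespace Summit.BirchSwinnertonDyer.BirchSwinnertonDyer.Theorems.PrintCf2.CMPrimes

/-! ## §1 (H1″) from the CM scalar on local points -/

section Local

variable {K : Type u} [Field K] [NumberField K] (V : WeierstrassCurve K) [V.IsElliptic] (p : ℕ) [Fact p.Prime]
  (π : V.endRing) (r : ℤ_[p]) (v : HeightOneSpectrum (𝓞 K))

set_option maxHeartbeats 800000 in
/-- **A classical class of the `r`-summand is locally zero at `v`, given the CM scalar on local points.** `M = E[𝔮_r^∞]`, `r − (1 − r)` a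
unit, `f_v` a `Γ_{K_v}`-equivariant additive extension of `π` to `E(K̄_v)` with (H1-pts) «`(f_v − N₁) E(K_v) ⊆ p^n E(K_v) + E[p^∞]`, `N₁ ≡ 1 − r`»:
if `ι_* c` dies in `H¹(Γ_{K_v}, E(K̄_v))` then `ι_* c` dies in `H¹(⊤ ⊓ D_v, E[p^∞])`. (adapted from -w7 g2's `localKerOver_top_le_awayKer`,
Summits/…/PrintCf2SplitBadTwoRestrictedSelmerLocalTrivialAwayFromP.lean) [cite: GreenbergLNM1716, §2 Prop. 2.1–2.2 (pp. 70–73)]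
[cite: Rubin1999, §3 Lemma 3.6 (ii), Cor. 3.17] -/
theorem resH1Hom_subtype_mem_awayKer_of_cmScalar (hunit : IsUnit (r - (1 - r)))
    (fE : localPoints V (v.adicCompletion K) →+ localPoints V (v.adicCompletion K))
    (hfE : ∀ (τ : absoluteGaloisGroup (v.adicCompletion K)) (P : localPoints V (v.adicCompletion K)), fE (τ • P) = τ • fE P)
    (hfEπ : ∀ P : V.geomPoints, fE (pointsMap V (v.adicCompletion K) P) =
      pointsMap V (v.adicCompletion K) ((π : AddMonoid.End V.geomPoints) P))
    (Hpts : ∀ y : localPoints V (v.adicCompletion K), (∀ σ : absoluteGaloisGroup (v.adicCompletion K), σ • y = y) →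
      ∀ n : ℕ, ∃ (y' : localPoints V (v.adicCompletion K)) (N₁ : ℤ) (k : ℕ),
        (∀ σ : absoluteGaloisGroup (v.adicCompletion K), σ • y' = y') ∧
        ((N₁ : ℤ_[p]) - (1 - r)) ∈ (Ideal.span {(p : ℤ_[p]) ^ n} : Ideal ℤ_[p]) ∧
        p ^ k • (fE y - N₁ • y - p ^ n • y') = 0)
    (c : subgroupH1 (⊤ : Subgroup (absoluteGaloisGroup K)) ↥(V.endEigenPrimaryTorsion p π r))
    (hc : resH1Hom (ContinuousMonoidHom.id _) (V.endEigenPrimaryTorsion p π r).subtype (fun _ _ ↦ rfl) c ∈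
      V.localKerOver p ⊤ (v.adicCompletion K)) :
    resH1Hom (ContinuousMonoidHom.id _) (V.endEigenPrimaryTorsion p π r).subtype (fun _ _ ↦ rfl) c ∈
      awayKer ⊤ (V.geomPrimaryTorsion p) v := by
  -- notation
  set E := v.adicCompletion K with hE
  set ι := closureEmb (K := K) (v.adicCompletion K) with hι
  obtain ⟨ψc, rfl⟩ := oneCocycleClass_surjective
    (discreteTopRep (⊤ : Subgroup (absoluteGaloisGroup K)) ↥(V.endEigenPrimaryTorsion p π r)) c
  rw [Literature.NumberTheory.EllipticCurves.resH1Hom_id_oneCocycleClass] at hc ⊢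
  set φE := contOneCocycles.push (V.endEigenPrimaryTorsion p π r).subtype
    (fun (_ : (⊤ : Subgroup (absoluteGaloisGroup K))) (_ : ↥(V.endEigenPrimaryTorsion p π r)) ↦ rfl) ψc with hφE
  have hφEval : ∀ g, (φE.1 g : V.geomPrimaryTorsion p) = ((ψc.1 g : ↥(V.endEigenPrimaryTorsion p π r)) : V.geomPrimaryTorsion p) :=
    fun _ ↦ rfl
  -- the classical condition: `ι φE(res τ) = τQ - Q` on `Γ_{K_v}`
  have hc' : resH1Hom (resGalSubgroupOfEmb ⊤ ι) ((pointsMapOfEmb V ι).comp (V.geomPrimaryTorsion p).subtype)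
      (fun τ P ↦ by
        simp only [AddMonoidHom.coe_comp, AddSubgroup.coe_subtype, Function.comp_apply, Subgroup.smul_def,
          resGalSubgroupOfEmb_apply_coe, Literature.NumberTheory.EllipticCurves.primaryComponent.coe_smul]
        exact pointsMapOfEmb_smul V ι τ P)
      (oneCocycleClass _ φE) = 0 := hc
  rw [resH1Hom_oneCocycleClass_eq_zero_iff] at hc'
  obtain ⟨Q, hQ⟩ := hc'
  -- finite image: `p^J φE = 0`
  haveI : CompactSpace (absoluteGaloisGroup K) := compactSpace_absoluteGaloisGroup K
  haveI : CompactSpace (⊤ : Subgroup (absoluteGaloisGroup K)) :=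
    isCompact_iff_compactSpace.mp (by rw [Subgroup.coe_top]; exact isCompact_univ)
  obtain ⟨J, hJ⟩ := exists_pow_smul_apply_eq_zero (p := p) φE.1 (fun g ↦ by
    obtain ⟨k, hk⟩ := (AddCommGroup.mem_primaryComponent).mp (φE.1 g).2
    exact ⟨k, Subtype.ext (by rw [AddSubmonoidClass.coe_nsmul, ZeroMemClass.coe_zero]; exact hk)⟩)
  -- `y := p^J Q` is `Γ_{K_v}`-rational
  have hy : ∀ σ : absoluteGaloisGroup E, σ • ((p ^ J : ℕ) • Q) = (p ^ J : ℕ) • Q := by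
    intro σ
    have h1 := hQ ⟨σ, (mem_localSubgroupOfEmb_iff ⊤ ι σ).mpr (Subgroup.mem_top _)⟩
    have h2 : σ • Q - Q = pointsMapOfEmb V ι ((φE.1 (resGalSubgroupOfEmb ⊤ ι ⟨σ, (mem_localSubgroupOfEmb_iff ⊤ ι σ).mpr
        (Subgroup.mem_top _)⟩) : V.geomPrimaryTorsion p) : V.geomPoints) := h1.symm
    rw [smul_comm, ← sub_eq_zero, ← smul_sub, h2, ← map_nsmul, ← AddSubmonoidClass.coe_nsmul, hJ, ZeroMemClass.coe_zero, map_zero]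
  set y : localPoints V E := (p ^ J : ℕ) • Q with hydef
  -- the CM input at level `J + 1`, and the eigen integer `N' ≡ r (mod p^(J+1))`
  obtain ⟨y', N₁, k, hy', hN₁, hk⟩ := Hpts y hy (J + 1)
  obtain ⟨N', hN'⟩ := exists_int_sub_mem_span_pow p r (J + 1)
  -- `N' - N₁ ≡ r - (1 - r)` is a unit; `b` is its inverse mod `p^J`
  have hunit' : IsUnit (((N' - N₁ : ℤ) : ℤ_[p])) := by
    have hmem : (((N' - N₁ : ℤ) : ℤ_[p]) - (r - (1 - r))) ∈ (Ideal.span {(p : ℤ_[p]) ^ (J + 1)} : Ideal ℤ_[p]) := by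
      have e : (((N' - N₁ : ℤ) : ℤ_[p]) - (r - (1 - r))) = (((N' : ℤ_[p]) - r)) - (((N₁ : ℤ_[p]) - (1 - r))) := by
        push_cast; ring
      rw [e]; exact Ideal.sub_mem _ hN' hN₁
    by_contra hx
    have hx' : ((N' - N₁ : ℤ) : ℤ_[p]) ∈ IsLocalRing.maximalIdeal ℤ_[p] := (IsLocalRing.mem_maximalIdeal _).mpr hx
    have hle : (Ideal.span {(p : ℤ_[p]) ^ (J + 1)} : Ideal ℤ_[p]) ≤ IsLocalRing.maximalIdeal ℤ_[p] := by
      rw [PadicInt.maximalIdeal_eq_span_p, Ideal.span_singleton_le_span_singleton]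
      exact dvd_pow_self _ (Nat.succ_ne_zero J)
    have hu : (r - (1 - r)) ∈ IsLocalRing.maximalIdeal ℤ_[p] := by
      have := Ideal.sub_mem _ hx' (hle hmem)
      rwa [sub_sub_cancel] at this
    exact (IsLocalRing.mem_maximalIdeal _).mp hu hunit
  obtain ⟨b, hb⟩ := exists_int_sub_mem_span_pow p ((hunit'.unit⁻¹ : ℤ_[p]ˣ) : ℤ_[p]) J
  have hA : (((b * (N' - N₁) : ℤ) : ℤ_[p]) - 1) ∈ (Ideal.span {(p : ℤ_[p]) ^ J} : Ideal ℤ_[p]) := by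
    have hw : ((N' - N₁ : ℤ) : ℤ_[p]) * ((hunit'.unit⁻¹ : ℤ_[p]ˣ) : ℤ_[p]) = 1 := hunit'.mul_val_inv
    have e : (((b * (N' - N₁) : ℤ) : ℤ_[p]) - 1) =
        (((b : ℤ_[p]) - ((hunit'.unit⁻¹ : ℤ_[p]ˣ) : ℤ_[p])) * ((N' - N₁ : ℤ) : ℤ_[p])) := by
      push_cast at hw ⊢
      linear_combination hw
    rw [e]; exact Ideal.mul_mem_right _ _ hb
  have hone : (((1 : ℤ) : ℤ_[p]) - 1) ∈ (Ideal.span {(p : ℤ_[p]) ^ J} : Ideal ℤ_[p]) := by simp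
  -- `ψ := b (π - N₁)` FIXES the values of the cocycle
  have hval : ∀ g, b • ((π : AddMonoid.End V.geomPoints) ((φE.1 g : V.geomPrimaryTorsion p) : V.geomPoints) -
      N₁ • ((φE.1 g : V.geomPrimaryTorsion p) : V.geomPoints)) = ((φE.1 g : V.geomPrimaryTorsion p) : V.geomPoints) := by
    intro g
    have hx : (φE.1 g : V.geomPrimaryTorsion p) ∈ V.endEigenPrimaryTorsion p π r := by
      rw [hφEval]; exact (ψc.1 g).2
    have hJg : p ^ J • (φE.1 g : V.geomPrimaryTorsion p) = 0 := hJ g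
    have hπx : (π : AddMonoid.End V.geomPoints) ((φE.1 g : V.geomPrimaryTorsion p) : V.geomPoints) =
        N' • ((φE.1 g : V.geomPrimaryTorsion p) : V.geomPoints) :=
      (eigen_of_endRing V p π r).2 J N' _ hx hJg (sub_mem_span_pow_of_le p (Nat.le_succ J) hN')
    have hJg' : p ^ J • ((φE.1 g : V.geomPrimaryTorsion p) : V.geomPoints) = 0 := by
      rw [← AddSubmonoidClass.coe_nsmul, hJg, ZeroMemClass.coe_zero]
    rw [hπx, ← sub_smul, ← mul_smul, zsmul_eq_zsmul_of_approx' p hJg' hA hone, one_smul]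
  -- the twisted point `Q' := b (f_v Q - N₁ Q)`, the rational correction `y₀ := b p y'`, the torsion point `T := Q' - y₀`
  set Q' : localPoints V E := b • (fE Q - N₁ • Q) with hQ'def
  set y₀ : localPoints V E := b • ((p : ℕ) • y') with hy₀def
  set T : localPoints V E := Q' - y₀ with hTdef
  have hy₀ : ∀ σ : absoluteGaloisGroup E, σ • y₀ = y₀ := fun σ ↦ by
    rw [hy₀def, smul_comm σ b, smul_comm σ (p : ℕ), hy' σ]
  have hJT : (p ^ J : ℕ) • T = b • (fE y - N₁ • y - (p ^ (J + 1) : ℕ) • y') := by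
    rw [hTdef, hQ'def, hy₀def, hydef, map_nsmul]
    module
  have hT : ((p ^ (J + k) : ℕ) : ℤ) • T = 0 := by
    rw [natCast_zsmul, pow_add, mul_comm, mul_smul, hJT, smul_comm, hk, smul_zero]
  -- on `Γ_{K_v}` the cocycle is `τ ↦ τT - T`
  have hfEπ' : ∀ P : V.geomPoints, fE (pointsMapOfEmb V ι P) = pointsMapOfEmb V ι ((π : AddMonoid.End V.geomPoints) P) := hfEπ
  have hQT : ∀ x : localSubgroupOfEmb (⊤ : Subgroup (absoluteGaloisGroup K)) ι,
      pointsMapOfEmb V ι ((φE.1 (resGalSubgroupOfEmb ⊤ ι x) : V.geomPrimaryTorsion p) : V.geomPoints) =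
        (x : absoluteGaloisGroup E) • T - T := by
    intro x
    have h1 : pointsMapOfEmb V ι ((φE.1 (resGalSubgroupOfEmb ⊤ ι x) : V.geomPrimaryTorsion p) : V.geomPoints) =
        (x : absoluteGaloisGroup E) • Q - Q := hQ x
    calc pointsMapOfEmb V ι ((φE.1 (resGalSubgroupOfEmb ⊤ ι x) : V.geomPrimaryTorsion p) : V.geomPoints)
        = pointsMapOfEmb V ι (b • ((π : AddMonoid.End V.geomPoints)
            ((φE.1 (resGalSubgroupOfEmb ⊤ ι x) : V.geomPrimaryTorsion p) : V.geomPoints) -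
            N₁ • ((φE.1 (resGalSubgroupOfEmb ⊤ ι x) : V.geomPrimaryTorsion p) : V.geomPoints))) := by rw [hval]
      _ = b • (fE (pointsMapOfEmb V ι ((φE.1 (resGalSubgroupOfEmb ⊤ ι x) : V.geomPrimaryTorsion p) : V.geomPoints)) -
            N₁ • pointsMapOfEmb V ι ((φE.1 (resGalSubgroupOfEmb ⊤ ι x) : V.geomPrimaryTorsion p) : V.geomPoints)) := by
          rw [map_zsmul, map_sub, map_zsmul, hfEπ']
      _ = b • (fE ((x : absoluteGaloisGroup E) • Q - Q) - N₁ • ((x : absoluteGaloisGroup E) • Q - Q)) := by rw [h1]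
      _ = (x : absoluteGaloisGroup E) • Q' - Q' := by
          rw [hQ'def, smul_comm (x : absoluteGaloisGroup E) b, smul_sub (x : absoluteGaloisGroup E), ← hfE,
            smul_comm (x : absoluteGaloisGroup E) N₁ Q, map_sub]
          simp only [smul_sub]
          abel
      _ = (x : absoluteGaloisGroup E) • T - T := by rw [hTdef, smul_sub, hy₀]; abel
  -- `T` is torsion of exponent `p^(J+k)`, hence algebraic
  have hn : ((p ^ (J + k) : ℕ) : ℤ) ≠ 0 := by exact_mod_cast (pow_pos (Fact.out : p.Prime).pos _).ne'
  set Tt : AddSubgroup.torsionBy (localPoints V E) ((p ^ (J + k) : ℕ) : ℤ) :=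
    ⟨T, by change ((p ^ (J + k) : ℕ) : ℤ) • T = 0; exact hT⟩ with hTtdef
  set t : V.geomTorsion ((p ^ (J + k) : ℕ) : ℤ) := (V.torsionPointsEquiv ((p ^ (J + k) : ℕ) : ℤ) (E := E) hn).symm Tt with htdef
  have ht : pointsMap V E (t : V.geomPoints) = T := by
    rw [htdef, V.pointsMap_torsionPointsEquiv_symm]
  have htp : (t : V.geomPoints) ∈ V.geomPrimaryTorsion p := by
    refine (AddCommGroup.mem_primaryComponent).mpr ⟨J + k, ?_⟩
    have h2 := t.2
    change ((p ^ (J + k) : ℕ) : ℤ) • (t : V.geomPoints) = 0 at h2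
    rw [natCast_zsmul] at h2
    exact h2
  -- the cocycle is the coboundary of `t` on the decomposition group
  change resOfLe (V.geomPrimaryTorsion p) (inf_le_left : ⊤ ⊓ decomp v ≤ ⊤) (oneCocycleClass _ φE) = 0
  rw [resOfLe, resH1Hom_oneCocycleClass_eq_zero_iff]
  refine ⟨⟨(t : V.geomPoints), htp⟩, fun g ↦ ?_⟩
  obtain ⟨σ, hσ⟩ := (mem_decomp_iff v (g : absoluteGaloisGroup K)).mp (Subgroup.mem_inf.mp g.2).2
  have h1 := hQT ⟨σ, (mem_localSubgroupOfEmb_iff ⊤ ι σ).mpr (Subgroup.mem_top _)⟩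
  have hg : (subgroupInclusion (inf_le_left : ⊤ ⊓ decomp v ≤ ⊤) g : (⊤ : Subgroup (absoluteGaloisGroup K))) =
      resGalSubgroupOfEmb ⊤ ι ⟨σ, (mem_localSubgroupOfEmb_iff ⊤ ι σ).mpr (Subgroup.mem_top _)⟩ := by
    apply Subtype.ext
    rw [resGalSubgroupOfEmb_apply_coe]
    exact hσ.symm
  apply Subtype.ext
  apply pointsMapOfEmb_injective V ι
  change pointsMapOfEmb V ι ((φE.1 (subgroupInclusion (inf_le_left : ⊤ ⊓ decomp v ≤ ⊤) g) : V.geomPrimaryTorsion p) : V.geomPoints) =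
    pointsMapOfEmb V ι (((g • (⟨(t : V.geomPoints), htp⟩ : V.geomPrimaryTorsion p) -
      (⟨(t : V.geomPoints), htp⟩ : V.geomPrimaryTorsion p) : V.geomPrimaryTorsion p) : V.geomPoints))
  rw [hg, h1, AddSubgroupClass.coe_sub, map_sub, Literature.NumberTheory.EllipticCurves.primaryComponent.coe_smul, Subgroup.smul_def]
  change _ = pointsMapOfEmb V ι ((g : absoluteGaloisGroup K) • (t : V.geomPoints)) - pointsMapOfEmb V ι (t : V.geomPoints)
  rw [← hσ]
  change _ = pointsMap V E (resGal (K := K) E σ • (t : V.geomPoints)) - pointsMap V E (t : V.geomPoints)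
  rw [pointsMap_smul, ht]

/-- **(H1″) ⟸ (H1-pts).** For complementary eigen-summands (`M ⊓ M̄ = ⊥`, `M ⊔ M̄ = ⊤`, `r − (1 − r)` a unit) and a `Γ_{K_v}`-equivariant
additive extension `f_v` of `π` to `E(K̄_v)` satisfying (H1-pts), the CM input (H1″) of the bottom value holds:
`ι_*⁻¹(localKerOver p ⊤ K_v) ≤ ker res_{⊤ ⊓ D_v}` on `H¹(K, E[𝔮_r^∞])` (`ι_*` is injective on `H¹(⊤ ⊓ D_v, ·)`, -w7 g2 `resH1Hom_subtype_injective`).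
[cite: GreenbergLNM1716, §2 Prop. 2.1–2.2 (pp. 70–73)] [cite: Agboola2007, §3 (arXiv p0008:L8–12)] -/
theorem comap_localKerOver_le_ker_resOfLe_of_cmScalar
    (hinf : V.endEigenPrimaryTorsion p π r ⊓ V.endEigenPrimaryTorsion p π (1 - r) = ⊥)
    (hsup : V.endEigenPrimaryTorsion p π r ⊔ V.endEigenPrimaryTorsion p π (1 - r) = ⊤) (hunit : IsUnit (r - (1 - r)))
    (fE : localPoints V (v.adicCompletion K) →+ localPoints V (v.adicCompletion K))
    (hfE : ∀ (τ : absoluteGaloisGroup (v.adicCompletion K)) (P : localPoints V (v.adicCompletion K)), fE (τ • P) = τ • fE P)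
    (hfEπ : ∀ P : V.geomPoints, fE (pointsMap V (v.adicCompletion K) P) =
      pointsMap V (v.adicCompletion K) ((π : AddMonoid.End V.geomPoints) P))
    (Hpts : ∀ y : localPoints V (v.adicCompletion K), (∀ σ : absoluteGaloisGroup (v.adicCompletion K), σ • y = y) →
      ∀ n : ℕ, ∃ (y' : localPoints V (v.adicCompletion K)) (N₁ : ℤ) (k : ℕ),
        (∀ σ : absoluteGaloisGroup (v.adicCompletion K), σ • y' = y') ∧
        ((N₁ : ℤ_[p]) - (1 - r)) ∈ (Ideal.span {(p : ℤ_[p]) ^ n} : Ideal ℤ_[p]) ∧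
        p ^ k • (fE y - N₁ • y - p ^ n • y') = 0) :
    (V.localKerOver p ⊤ (v.adicCompletion K)).comap
        (resH1Hom (ContinuousMonoidHom.id _) (V.endEigenPrimaryTorsion p π r).subtype (fun _ _ ↦ rfl)) ≤
      (resOfLe ↥(V.endEigenPrimaryTorsion p π r) (inf_le_left : ⊤ ⊓ decomp v ≤ ⊤)).ker := by
  intro c hc
  rw [AddSubgroup.mem_comap] at hc
  have hc2 := resH1Hom_subtype_mem_awayKer_of_cmScalar V p π r v hunit fE hfE hfEπ Hpts c hc
  obtain ⟨e, he₁, -, -, he⟩ := exists_eigenProjector V p π r (1 - r) hinf hsup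
  rw [AddMonoidHom.mem_ker]
  apply resH1Hom_subtype_injective V p π r (⊤ ⊓ decomp v) e he₁ he
  rw [map_zero, ← resOfLe_resH1Hom_subtype V p π r]
  exact hc2

end Local

/-! ## §2 Factor (F2) on the frame from the CM scalar on local points -/

section Frame

variable {K : Type} [Field K] [NumberField K]

/-- **Factor (F2) on the frame ⟸ (H1-pts) at `v`.** For a member `C • W = cm7^{(d)}` (`d ≠ 0`) over an imaginary quadratic `K` with
`2 = v·v̄` (`v̄ ≠ v`), `π ∈ End_K(E_K)` with `π² = π − 2`, `r² = r − 2`: IF some `Γ_{K_v}`-equivariant additive extension `f_v` of `π` to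
`E(K̄_v)` satisfies (H1-pts) («`π ≡ 1 − r` on `E(K_v) ⊗ ℤ₂` modulo torsion and `2^n`»), THEN hF2's inner statement of `rBV_of_three_factor_values`
holds: `v₂ #((𝔖_v(K, E[𝔮_r^∞]) ⊓ L_M) ⧸ Q_M) = v₂ #Ш(W/ℚ)[2^∞]`. [cite: Agboola2007, Props. 6.10–6.11 (arXiv p0014:L1–p0015:L12)]
[cite: GreenbergLNM1716, §2 pp. 62–63, 70–73] -/
theorem padicValNat_trueSelmer_quotient_eq_sha_of_frame_of_cmScalar {d : ℤ} (hd0 : d ≠ 0) (W : WeierstrassCurve ℚ) [W.IsElliptic]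
    (C : WeierstrassCurve.VariableChange ℚ) (hCW : C • W = cm7.quadraticTwist (d : ℚ)) (hK : IsImaginaryQuadratic K)
    (v vbar : HeightOneSpectrum (𝓞 K)) (hv : ((2 : ℕ) : 𝓞 K) ∈ v.asIdeal) (hvbar : ((2 : ℕ) : 𝓞 K) ∈ vbar.asIdeal) (hne : vbar ≠ v)
    (π : (W.baseChange K).endRing) (hrel : (π : AddMonoid.End (W.baseChange K).geomPoints) * π = π - 2)
    {r : ℤ_[2]} (hr : r * r = r - 2)
    (Hpts : ∃ fE : localPoints (W.baseChange K) (v.adicCompletion K) →+ localPoints (W.baseChange K) (v.adicCompletion K),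
      (∀ (τ : absoluteGaloisGroup (v.adicCompletion K)) (P : localPoints (W.baseChange K) (v.adicCompletion K)),
          fE (τ • P) = τ • fE P) ∧
      (∀ P : (W.baseChange K).geomPoints, fE (pointsMap (W.baseChange K) (v.adicCompletion K) P) =
          pointsMap (W.baseChange K) (v.adicCompletion K) ((π : AddMonoid.End (W.baseChange K).geomPoints) P)) ∧
      ∀ y : localPoints (W.baseChange K) (v.adicCompletion K),
        (∀ σ : absoluteGaloisGroup (v.adicCompletion K), σ • y = y) →
        ∀ n : ℕ, ∃ (y' : localPoints (W.baseChange K) (v.adicCompletion K)) (N₁ : ℤ) (k : ℕ),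
          (∀ σ : absoluteGaloisGroup (v.adicCompletion K), σ • y' = y') ∧
          ((N₁ : ℤ_[2]) - (1 - r)) ∈ (Ideal.span {(2 : ℤ_[2]) ^ n} : Ideal ℤ_[2]) ∧
          2 ^ k • (fE y - N₁ • y - 2 ^ n • y') = 0) :
    padicValNat 2 (Nat.card (↥(restrictedSelmerBase ↥((W.baseChange K).endEigenPrimaryTorsion 2 π r) 2 v ⊓
            (((W.baseChange K).localKerOver 2 ⊤ (vbar.adicCompletion K)).comap
          (resH1Hom (ContinuousMonoidHom.id _) ((W.baseChange K).endEigenPrimaryTorsion 2 π r).subtype (fun _ _ ↦ rfl)))) ⧸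
          (((((W.baseChange K).kummerMapPInfty 2 (W.baseChange K).zsmul_geomPoints_surjective_holds).range).map
            (resSubgroup ⊤ ((W.baseChange K).geomPrimaryTorsion 2))).comap
          (resH1Hom (ContinuousMonoidHom.id _) ((W.baseChange K).endEigenPrimaryTorsion 2 π r).subtype (fun _ _ ↦ rfl))).addSubgroupOf
            (restrictedSelmerBase ↥((W.baseChange K).endEigenPrimaryTorsion 2 π r) 2 v ⊓
              (((W.baseChange K).localKerOver 2 ⊤ (vbar.adicCompletion K)).comap
          (resH1Hom (ContinuousMonoidHom.id _) ((W.baseChange K).endEigenPrimaryTorsion 2 π r).subtype (fun _ _ ↦ rfl)))))) =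
      padicValNat 2 (Nat.card (AddCommGroup.primaryComponent W.sha 2)) := by
  obtain ⟨fE, hfE, hfEπ, H⟩ := Hpts
  obtain ⟨hinf, hsup⟩ := endEigenPrimaryTorsion_compl_of_frame hd0 W C hCW K π hrel hr
  have hunit : IsUnit (r - (1 - r)) := (two_dvd_or_two_dvd_one_sub_of_root hr).2
  exact padicValNat_trueSelmer_quotient_eq_sha_of_frame_of_H1 hd0 W C hCW hK v vbar hv hvbar hne π hrel hr
    (comap_localKerOver_le_ker_resOfLe_of_cmScalar (W.baseChange K) 2 π r v hinf hsup hunit fE hfE hfEπ H)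

end Frame

end Summit.BirchSwinnertonDyer.BirchSwinnertonDyer.Theorems.PrintCf2.CMPrimes

end
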